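import Summits.QuantumFields.YangMills.Theorems.BalabanUVNodesN11K1SupportsAtUnitResidual
import Summits.QuantumFields.YangMills.Theorems.BalabanUVNodesN11OmegaTopTStep
import Summits.QuantumFields.YangMills.Theorems.BalabanUVNodesN11GaussianCertificateRows
import Summits.QuantumFields.YangMills.Theorems.BalabanUVNodesN11AFibreDominationOfCoercive
import Summits.QuantumFields.YangMills.Theorems.BalabanUVNodesN11TkOpMeasurable

/-!
# DAG node N11 ∕ key K1⁹ — AT THE GAUSSIAN-DIAL UNIT RESIDUAL THE SUPPORT CONDITION HOLDS OUTRIGHT ON THE WHOLE Ω-TOP FAMILY: next to every `θ`, the residual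
# `ζ0_j(Y) := 𝟙{Y = Ω_{j+1}ᶜ}`, `quad_j(Λ′) := Σ_{b ∈ B_j(Λ′ᶜ ∩ Ω_{j+1})} ‖A_j(b)‖²` (rows OUTRIGHT, inside K1⁹'s hypothesis class) has its reference new side `J⁰_P(s′)`
# STRICTLY POSITIVE AT EVERY new field `V′` at EVERY child with `Ω_{k+1}(s′) = 𝕋` — the small-field MAIN TERM `(𝕋,…,𝕋; 𝕋)` and every new large-fluctuation child
# `(𝕋,…,𝕋; Λ_{k+1})` — with ZERO terms; hence H's switch–dial identity holds there with NO support hypothesis: the v10 𝐒∕𝐓-law clauses of the main term are met by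
# fiat OUTRIGHT (count-neutral, LOCATED; FLAG №15 kernel certificate #5: on the Ω-top family the certificates #2∕#4 need no hypothesis at all)

HEADER — WORK-UNIT METADATA.  Cell `pub-ymgap`, YM-PLAN Track A (HUMAN RULING D-0062), seat `pub-ymgap-dag-n11-d` (g36; N11 [B14], s2), route `BalabanUVNodes`, item K1⁹ =
stmt-QuantumFields-27364 (helper lane, `--kind proof --supports 27364 --as helper`, count-neutral).  [III] = [Balaban1988Convergent], [I] = [Balaban1987RG1], [IV] =
[Balaban1989LargeFieldI], [V] = [Balaban1989LargeFieldII].  Over this seat's `…N11K1SupportsAtUnitResidual` (g35 J: the unit-residual rows `zhLaws∕zhLocal∕zhUnity_of_unitResidual`,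
`WtOfRecord₁₃H_ζ_region_eq_one`; the `sameR` transports), `…N11K1BFaceSect2FormBySupports` (g34 H §1: `target_eq_sect2Slot_of_switch_dial`), `…N11OmegaTopTStep` (g18: the closed form
`sect2Slot_eq_of_Omega_univ` of 11a's `𝐓_{k+1}(s′)` at `Ω_{k+1} = 𝕋`), `…N11TkOpMeasurable` (g9: `measurable_tkWeightsOfRecordP_w`), `…N11TopPairLocalResidual` (`WtOfRecord₁₃H_ζ_eq_ζ0`,
`WtOfRecord₁₃H_w_univ_empty_empty`), dag-n11-w1's `…N11GaussianCertificateRows` (the GAUSSIAN form slot of `gaussPinH`, `measurable_quad_of_gaussCert`), dag-n11-w4's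
`…N11AFibreDominationOfCoercive` (the Gaussian majorant: `lintegral_gaussMajorant_ne_top`, `exp_neg_half_le_gaussMajorant`), 11a (`aOp_apply`, `aOp_nonneg`, `insA`, `baseCfg`), 11c
(`sect2Operand`, `sect2Slot`, `Sect2.action23_actionDataOfTerms`, `TermValues.zero`), 12a (`chiAW`, `chiSmallAW_eq_ite`, `chiAW_nonneg∕_le_one`, `deltaOfRecord`), def-T's `TkNoExpansionStepZero`
(`cubesIn_cubeχ_empty`, `chiLargeAW_empty`, `chiPrimeW_empty`), RECORD 13 v1.7 `H` (`Stage13HParams`, `WtOfRecord₁₃H`, `zhAt`).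

WHY THIS FILE (g34 trigger (t3) ∕ g35 trigger (u3), taken in its geometry-free form).  FILES H∕I∕J (✓p731134, ✓p732681, ✓p733083) reduced K1⁹'s consequent to its residual-blind
remainder PLUS one qualitative statement per history — the SUPPORT INCLUSION «a.e. on the `χ_{k+1}(s)`-support: `0 < ρ_{k+1}(s)(V) → 0 < J⁰_P(s)(V)`» — and J read it at the BARE
unit residual (`quad ≡ 0`).  Two things were left open.  (a) At `quad ≡ 0` the inclusion is JUNK-SENSITIVE: an integrated A-coordinate outside every (3.16) star `(□′^{∼2})^{(k)*}`
of a χ_{k+1}-cube inside the region has an undamped, infinite Lebesgue fibre, and the Bochner integral of a non-integrable integrand is `0` — dag-n11-w1's kernel-checked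
`…N11AFibreDominationRow.not_afibre_dominated_rePinH_of_uncovered` (regions too thin for a χ-cube whenever `M < L·M₂`; the witness of record has `M = 1`); so off the top child the
bare hypothesis of cert #4 is not evidently inhabitable.  (b) Where it IS inhabitable nothing had been proved.  THIS FILE settles the whole Ω-TOP FAMILY at the GAUSSIAN DIAL
`quad_j(Λ′) := Σ_{b ∈ B_j(Λ′ᶜ ∩ Ω_{j+1})} ‖A_j(b)‖²` (dag-n11-w1's `gaussPinH` form slot VERBATIM; it reads no datum of `θ` beyond `toStage13RParams` and the history, so the
located sentence of I∕J stands: the residual slots carry no content) — with NO cube geometry: the Gaussian damps every coordinate, covered or not.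

WHAT THIS FILE PROVES (0 `sorry`, 0 `def`, standard axioms).  §0 bookkeeping: `action23_zero_congr_fluct` ∕ `sect2Operand_zero_congr_fluct` ∕ `sect2Operand_zero_update_eq` (ZERO term
values ⇒ the (2.23) action and 11c's operand `e^{A_n(s)}` do NOT read the fluctuation variables: the only `A`-dependent summand, the (2.40) boundary sum `𝐁`, vanishes termwise),
`Omega_eq_univ_of_Omega_succ_univ` ((2.1): `Ω_{k+1} = 𝕋 ⇒ Ω_i = 𝕋`, `1 ≤ i ≤ k+1`), `bondsIn_empty`, `chiAW_empty_eq_chiSmallAW'` (w1's face over def-T's empty-family faces).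
§1 THE GAUSSIAN-DIAL UNIT RESIDUAL CLASS next to `θ` (hypothesis-keyed, as J: `hζ`, `hq`): `exists_gaussUnitResidual` (inhabited next to every `θ`, same `Stage13RParams` AND `Phih`),
`exists_gaussUnitResidual_fullClass` (inside K1⁹'s FULL hypothesis class from `θ`'s three R-side conjuncts — rows by J's lemmas, `ZhUnity` MANUFACTURED), `quad_univ_eq_zero`
(`quad_j(𝕋) ≡ 0`: no variable integrated), `w_univ_empty_empty_eq_one`, `ζ_empty_eq_one_of_Omega_univ` (at an Ω-top history every `ζ_j(∅) = 1`, `j ≤ k`).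
§2 ★★★ POSITIVITY.  `integral_afibre_emptyBranch_pos`: at a configuration with vanishing scale-`k` fluctuation variables, the `S_{k+1} = ∅` A-fibre integral
`∫ χ_A(Y, ∅)(a)·e^{−½ Σ_{b∈B_k(Y)} ‖a_b‖²} da` over `B_k(Y) → FluctV N` is `> 0` for `δ_k > 0` — measurable integrand, dominated by dag-n11-w4's Gaussian majorant (integrable:
`lintegral_gaussMajorant_ne_top`), equal to `e^{−½‖a‖²} > 0` on the (3.16) box `{‖a_b‖ < δ_k ∀b}` = `Metric.ball 0 δ_k` (off-fibre bonds read `0`), which has positive product-Lebesgue mass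
(`IsOpen.measure_pos`); `integral_pos_iff_support_of_nonneg`.  `integral_afibre_emptyBranch_mul_pos` (times any factor constant along the fibre).  ★★★ `sect2Slot_pos_of_Omega_univ`: for ANY
weight datum `W` with the dial's A-side, `ζ_j(∅) = 1` below the top and a positive top factor, ANY setting ∕ residual ∕ constant ∕ background map and ZERO terms, `0 < sect2Slot(W, s′, 0, E, U)(V′)`
at every `V′` whenever `Ω_{k+1}(s′) = 𝕋`: g18's closed form is a sum of nonnegative `Y`-summands whose `Y = ∅` summand is `ζ_k · c₀ · ∫ (fibre integrand) > 0`, `c₀ = e^{A_{k+1}(s′;0,E)(U(base V′))}`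
(the lower scalars are `1`; the operand is fluctuation-blind, §0).  ★★★ `refNewSide_pos_of_Omega_univ`: H's reference new side `J⁰_P(s′)` (the dial's weights, top `ζ`-factor `:= 1`) is
`> 0` EVERYWHERE at every Ω-top child — the support hypothesis of certs #2∕#4 HOLDS OUTRIGHT there (for every `V′`, not only a.e., whatever `ρ_{k+1}(s′)`).  ★★ `newSide_pos_of_Omega_univ`
(the dial's own §2-form slot, top factor `ζ_k(∅) = 1`).  CONSUMERS (sequel `…N11K1SupportsOffOmegaTopReduction`): H §1's switch–dial identity at every Ω-top child with `hTJ`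
DISCHARGED (the v10 𝐒∕𝐓-law clause of the small-field MAIN TERM met by fiat, zero terms, no hypothesis), and K1⁹'s consequent from its residual-blind remainder + supports at the
NON-Ω-top children only.

HONEST FRAMING.  Count-neutral LOCATED instrument (director-ym №292: FLAG №15 certificates are instruments, not content): kernel bookkeeping + folklore measure theory over the tree's own
objects; nothing of Bałaban asserted or refuted; the Gaussian dial is NOT print's `⟨A, Δ^{(k)}A⟩` of [I] (1.15) and the indicator `ζ0` is NOT print's resummed `ζ(Ω_{k+1}ᶜ)` — they are a
ROW-ABIDING member of the typed class exhibiting that K1⁹ v10's residual rows constrain neither; `δ_k > 0` is a displayed hypothesis (print's (3.4), `deltaOfRecord_pos`); the support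
condition at the NON-Ω-top children (a genuine V-transport: `map avg Haar ∼ Haar` on the restricted block averaging — N03∕N23-type content) is NOT touched; no `Stage13HParams` of record
constructed or modified; N11 NOT discharged; K1⁹ NOT closed; no K1⁹ witness; no registered stub touched; counts unmoved (typed 28∕28 · discharged 8∕27 = 8∕28 incl. NODE O).  One
finite four-torus programme at fixed `ε = L^{−K}`; NOT ℝ⁴, NOT OS, NOT a mass gap, NOT Clay.  No `sorry`, `axiom`, `def`, `instance`, `notation`.  Sources (SHAPE only): [III] Thm 1
p.262, (2.1) p.254, (2.17)–(2.18) p.257, (2.20)–(2.23) p.258, (2.40)–(2.41) p.261, (3.4) p.265, p.267, (3.16) p.268, (3.20)–(3.21) p.269, (3.23)–(3.25) p.270; [I] (1.15)–(1.16) p.262,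
(2.11) p.267 (shape of the Gaussian only); [V] Thm 1 p.355; [IV] (0.2)–(0.4) pp.176–177.
-/

noncomputable section

open MeasureTheory
open scoped BigOperators Matrix.Norms.L2Operator

namespace Summit.QuantumFields.YangMills.Theorems.BalabanUVNodesN11K1SupportsOmegaTopGaussianDial

open Literature.MathematicalPhysics.QuantumFieldTheory.Balaban1983to89 T4Continuum
open T4AdjointCovariance (insA JCfg)
open Node00 Node00.Tk B14.Eq218Concrete B14.Sect3Decomp
open B10Eq42TorusConstraint (bondsIn mem_bondsIn_iff)
open B14.Eq316 (SmallFluct)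
open BalabanUVNodesN11TopPairLocalResidual (WtOfRecord₁₃H_ζ_eq_ζ0 WtOfRecord₁₃H_w_univ_empty_empty)
open BalabanUVNodesN11TopPairQuadSlotK1Hypotheses (provisos₁₃SepCoPH_of_sameR slotsNondegenerate₁₃_of_sameR admissible_of_sameR)
open BalabanUVNodesN11K1SupportsAtUnitResidual (zhLaws_of_unitResidual zhLocal_of_unitResidual zhUnity_of_unitResidual WtOfRecord₁₃H_ζ_region_eq_one)
open BalabanUVNodesN11OmegaTopTStep (sect2Slot_eq_of_Omega_univ)
open BalabanUVNodesN11GaussianCertificateRows (measurable_quad_of_gaussCert)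
open BalabanUVNodesN11AFibreDominationOfCoercive (measurable_gaussMajorant lintegral_gaussMajorant_ne_top exp_neg_half_le_gaussMajorant)
open BalabanUVNodesN11TkOpMeasurable (measurable_tkWeightsOfRecordP_w)

variable {F : T4Family} {N : ℕ} [NeZero N]

/-! ## §0. Two pieces of bookkeeping: zero terms do not read the fluctuation variables; an Ω-top history is all-small -/

section Bookkeeping

/-- **WITH ZERO TERM VALUES THE (2.23) ACTION DOES NOT READ THE FLUCTUATION VARIABLES** (its only `A`-dependent summand, the (2.40) boundary sum `𝐁`, vanishes termwise).
[cite: Balaban1988Convergent, (2.23) p.258, (2.40)–(2.41) p.261 (bookkeeping)] -/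
theorem action23_zero_congr_fluct {P : Params} {G : Type*} [GaugeGroup G] {𝔸 : Type*} [NormedRing 𝔸] [NormedAlgebra ℂ 𝔸] [CompleteSpace 𝔸] {V : Type} {M : ℕ}
    (S : Sect2.Setting 𝔸 G) (Rz : Sect2.Residual P 𝔸) (ν : Stage7Numerics) (g : ℕ → ℝ) (Ω Λ : ℕ → Set (Site P 0)) (n : ℕ) (S' : ℕ → Set (Site P 0))
    (a a' : MSFluct P V) (Ek : ℝ) (U : GaugeField P 0 G) :
    (Sect2.actionDataOfTerms S Rz ν M g Ω Λ (Sect2.TermValues.zero : Sect2.TermValues P 𝔸 V M) n (S', a) Ek).action23 n U =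
      (Sect2.actionDataOfTerms S Rz ν M g Ω Λ (Sect2.TermValues.zero : Sect2.TermValues P 𝔸 V M) n (S', a') Ek).action23 n U := by
  rw [Sect2.action23_actionDataOfTerms, Sect2.action23_actionDataOfTerms]
  congr 2

/-- … hence 11c's operand `exp A_n(s)` with zero terms is the same at any two fluctuation data. [cite: Balaban1988Convergent, (2.18) p.257, (2.23) p.258 (bookkeeping)] -/
theorem sect2Operand_zero_congr_fluct {𝔸 : Type*} [NormedRing 𝔸] [NormedAlgebra ℂ 𝔸] [CompleteSpace 𝔸] {V : Type} (K : ℕ) (Sg : Sect2.Setting 𝔸 (SU N))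
    (Rz : Sect2.Residual (F.P K) 𝔸) {ν : Stage7Numerics} {M : ℕ} {g : ℕ → ℝ} {n : ℕ} (s : SeqOfRecord F ν M g K n) (Ek : ℝ) (U : BgMap F N K)
    (S' : ℕ → Set (Site (F.P K) 0)) (a a' : MSFluct (F.P K) V) (W : B15DeterminingSets.MSField (F.P K) (SU N)) :
    sect2Operand F N V K Sg Rz s (Sect2.TermValues.zero : Sect2.TermValues (F.P K) 𝔸 V M) Ek U (S', a) W =
      sect2Operand F N V K Sg Rz s (Sect2.TermValues.zero : Sect2.TermValues (F.P K) 𝔸 V M) Ek U (S', a') W := by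
  exact congrArg Real.exp (action23_zero_congr_fluct Sg Rz ν g s.Ω s.Λ n S' a a' Ek (U W))

/-- … in particular replacing the scale-`k` component of a configuration by one with the same gauge variables does not change the operand (zero terms).
[cite: Balaban1988Convergent, (2.18) p.257, (2.23) p.258 (bookkeeping)] -/
theorem sect2Operand_zero_update_eq {𝔸 : Type*} [NormedRing 𝔸] [NormedAlgebra ℂ 𝔸] [CompleteSpace 𝔸] {V : Type} (K : ℕ) (Sg : Sect2.Setting 𝔸 (SU N))
    (Rz : Sect2.Residual (F.P K) 𝔸) {ν : Stage7Numerics} {M : ℕ} {g : ℕ → ℝ} {n : ℕ} (s : SeqOfRecord F ν M g K n) (Ek : ℝ) (U : BgMap F N K)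
    (S' : ℕ → Set (Site (F.P K) 0)) (ω : MultiCfg (F.P K) (SU N) V) (k : ℕ) (c : JCfg (F.P K) k (SU N) V) (hc : c.1 = (ω k).1) :
    sect2Operand F N V K Sg Rz s (Sect2.TermValues.zero : Sect2.TermValues (F.P K) 𝔸 V M) Ek U
        (S', fun j => ((Function.update ω k c) j).2) (fun j => ((Function.update ω k c) j).1) =
      sect2Operand F N V K Sg Rz s (Sect2.TermValues.zero : Sect2.TermValues (F.P K) 𝔸 V M) Ek U (S', fun j => (ω j).2) (fun j => (ω j).1) := by
  rw [sect2Operand_zero_congr_fluct K Sg Rz s Ek U S' _ (fun j => (ω j).2)]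
  congr 1
  funext j
  by_cases hj : j = k
  · subst hj; rw [Function.update_self, hc]
  · rw [Function.update_of_ne hj]

omit [NeZero N] in
/-- **(2.1): A HISTORY WITH `Ω_{k+1} = 𝕋` IS ALL-SMALL** — every `Ω_i`, `1 ≤ i ≤ k+1`, is the whole torus (`Ω_{k+1} ⊆ Ω_i`). [cite: Balaban1988Convergent, (2.1) p.254] -/
theorem Omega_eq_univ_of_Omega_succ_univ {ν : Stage7Numerics} {M : ℕ} {g : ℕ → ℝ} {K k : ℕ} (s' : SeqOfRecord F ν M g K (k + 1)) (hΩ : s'.Ω (k + 1) = Set.univ)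
    {i : ℕ} (h1 : 1 ≤ i) (hi : i ≤ k + 1) : s'.Ω i = Set.univ :=
  Set.eq_univ_of_univ_subset (hΩ ▸ s'.chain.Ω_antitone h1 hi le_rfl)

omit [NeZero N] in
/-- No level-`j` bond lies in the empty region. [cite: Balaban1985Variational, (3) p.278 (bookkeeping)] -/
theorem bondsIn_empty {K : ℕ} (j : ℕ) : bondsIn j (∅ : Set (Site (F.P K) 0)) = ∅ :=
  Set.eq_empty_of_forall_notMem fun _ hb => hb.1

/-- 12a's `χ_A(Y, ∅)` is the (3.16) small-fluctuation indicator of the χ_{j+1}-cubes inside `Y` alone (`𝟙[∅ ⊆ Y] = 1`, `χ^{(j)c}(∅) = χ′(∅) = 1`; dag-n11-w1's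
`…N11AFibreDominationRow.chiAW_empty_eq_chiSmallAW`, restated over def-T's faces to keep this file's import cone small). [cite: Balaban1988Convergent, (3.16) p.268, (3.21) p.269 (bookkeeping)] -/
theorem chiAW_empty_eq_chiSmallAW' {V : Type} [SeminormedAddCommGroup V] (ν : Stage7Numerics) (A₁ : ℝ) (p : B12.RunParams) (g : ℕ → ℝ) (j : ℕ)
    (Y : Set (Site (F.P p.K) 0)) (ω : MultiCfg (F.P p.K) (SU N) V) :
    chiAW F N V ν A₁ p g j Y ∅ ω = chiSmallAW F N V ν A₁ p g j (cubesIn (cubeχ F ν p g j) Y) ω := by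
  unfold chiAW
  rw [if_pos (Set.empty_subset Y), one_mul, Set.sdiff_empty, cubesIn_cubeχ_empty, chiLargeAW_empty, chiPrimeW_empty, mul_one, mul_one]

end Bookkeeping

/-! ## §1. The Gaussian-dial unit residual class next to `θ`: indicator `ζ0`, Gaussian `quad`; rows OUTRIGHT; inhabited -/

section Dial

variable {θ θg : Stage13HParams F N}

/-- **THE GAUSSIAN-DIAL UNIT RESIDUAL CLASS IS INHABITED NEXT TO EVERY `θ`** (same `Stage13RParams` data AND `Phih`): the history-adapted indicator `ζ0_j(Y) := 𝟙{Y = Ω_{j+1}ᶜ}`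
of this seat's `…N11K1SupportsAtUnitResidual` together with the GAUSSIAN OF THE INTEGRATED VARIABLES `quad_j(Λ′)(ω) := Σ_{b ∈ B_j(Λ′ᶜ ∩ Ω_{j+1})} ‖A_j(b)‖²` (dag-n11-w1's
`gaussPinH` form slot). [cite: Balaban1988Convergent, p.267, (3.16)–(3.20) pp.268–269, (2.21) p.258 (bookkeeping)] -/
theorem exists_gaussUnitResidual (θ : Stage13HParams F N) :
    ∃ θg : Stage13HParams F N, θg.toStage13RParams = θ.toStage13RParams ∧ θg.Phih = θ.Phih ∧
      (∀ p n Ω Λ j Y ω, (θg.Zh p n Ω Λ).ζ0 j Y ω = Set.indicator {(Ω (j + 1))ᶜ} (1 : Set (Site (F.P p.K) 0) → ℝ) Y) ∧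
      (∀ p n Ω Λ j Λ' ω, (θg.Zh p n Ω Λ).quad j Λ' ω = ∑ b ∈ (Set.toFinite (bondsIn j (Λ'ᶜ ∩ Ω (j + 1)))).toFinset, ‖(ω j).2 b‖ ^ 2) :=
  ⟨{ θ with Zh := fun p _ Ω _ => ⟨fun j Y _ => Set.indicator {(Ω (j + 1))ᶜ} (1 : Set (Site (F.P p.K) 0) → ℝ) Y,
      fun j Λ' ω => ∑ b ∈ (Set.toFinite (bondsIn j (Λ'ᶜ ∩ Ω (j + 1)))).toFinset, ‖(ω j).2 b‖ ^ 2⟩ },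
    rfl, rfl, fun _ _ _ _ _ _ _ => rfl, fun _ _ _ _ _ _ _ => rfl⟩

variable (hζ : ∀ p n Ω Λ j Y ω, (θg.Zh p n Ω Λ).ζ0 j Y ω = Set.indicator {(Ω (j + 1))ᶜ} (1 : Set (Site (F.P p.K) 0) → ℝ) Y)
  (hq : ∀ p n Ω Λ j Λ' ω, (θg.Zh p n Ω Λ).quad j Λ' ω = ∑ b ∈ (Set.toFinite (bondsIn j (Λ'ᶜ ∩ Ω (j + 1)))).toFinset, ‖(ω j).2 b‖ ^ 2)

/-- ★ **THE CLASS LIES INSIDE K1⁹'s HYPOTHESIS CLASS NEXT TO ANY `θ` WITH THE THREE R-SIDE CONJUNCTS** (rows `zhLaws` ∕ `zhLocal` ∕ `ZhUnity` OUTRIGHT — they read `ζ0` only, J §2).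
[cite: Balaban1988Convergent, p.267, (3.16)–(3.20) pp.268–269 (bookkeeping)] -/
theorem exists_gaussUnitResidual_fullClass (θ : Stage13HParams F N) (hP : θ.Provisos₁₃SepCoPH F N) (hS : θ.SlotsNondegenerate₁₃ F N) (hA : θ.Admissible F N) :
    ∃ θg : Stage13HParams F N, θg.toStage13RParams = θ.toStage13RParams ∧ θg.Phih = θ.Phih ∧
      (∀ p n Ω Λ j Y ω, (θg.Zh p n Ω Λ).ζ0 j Y ω = Set.indicator {(Ω (j + 1))ᶜ} (1 : Set (Site (F.P p.K) 0) → ℝ) Y) ∧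
      (∀ p n Ω Λ j Λ' ω, (θg.Zh p n Ω Λ).quad j Λ' ω = ∑ b ∈ (Set.toFinite (bondsIn j (Λ'ᶜ ∩ Ω (j + 1)))).toFinset, ‖(ω j).2 b‖ ^ 2) ∧
      θg.Provisos₁₃SepCoPH F N ∧ (θg.ZhUnity ∧ θg.SlotsNondegenerate₁₃ F N) ∧ θg.Admissible F N := by
  obtain ⟨θg, h1, h2, hζ, hq⟩ := exists_gaussUnitResidual θ
  exact ⟨θg, h1, h2, hζ, hq, provisos₁₃SepCoPH_of_sameR h1 hP (zhLaws_of_unitResidual hζ) (zhLocal_of_unitResidual hζ),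
    ⟨zhUnity_of_unitResidual hζ, slotsNondegenerate₁₃_of_sameR h1 hS⟩, admissible_of_sameR h1 hA⟩

include hq in
/-- The Gaussian dial for the whole torus as small-field domain integrates NO variable: `quad_j(𝕋) ≡ 0`. [cite: Balaban1988Convergent, (2.21) p.258 (bookkeeping)] -/
theorem quad_univ_eq_zero (p : B12.RunParams) (n : ℕ) (Ω Λ : ℕ → Set (Site (F.P p.K) 0)) (j : ℕ) (ω : MultiCfg (F.P p.K) (SU N) (FluctV N)) :
    (θg.Zh p n Ω Λ).quad j Set.univ ω = 0 := by
  rw [hq, Set.compl_univ, Set.empty_inter, bondsIn_empty]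
  simp

include hq in
/-- … so the A-side factor of the empty regions is `1` at the Gaussian dial: `w_j(𝕋, ∅, ∅) ≡ 1`. [cite: Balaban1988Convergent, (2.21)–(2.22) p.258 (bookkeeping)] -/
theorem w_univ_empty_empty_eq_one (p : B12.RunParams) {n : ℕ} (s : SeqOfRecord F θg.ν θg.τ9.M (gOfRecord₁₃ F N θg.toStage13Params p) p.K n) (j : ℕ)
    (ω : MultiCfg (F.P p.K) (SU N) (FluctV N)) : (WtOfRecord₁₃H F N θg p s).w j Set.univ ∅ ∅ ω = 1 := by
  rw [WtOfRecord₁₃H_w_univ_empty_empty, quad_univ_eq_zero hq, mul_zero, Real.exp_zero]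

include hζ in
/-- At an Ω-top history every generation's `ζ`-factor at the empty region is `1` (`Ω_{j+1} = 𝕋`, `j ≤ k`). [cite: Balaban1988Convergent, (2.1) p.254, p.267 (bookkeeping)] -/
theorem ζ_empty_eq_one_of_Omega_univ (p : B12.RunParams) {k : ℕ} (s' : SeqOfRecord F θg.ν θg.τ9.M (gOfRecord₁₃ F N θg.toStage13Params p) p.K (k + 1))
    (hΩ : s'.Ω (k + 1) = Set.univ) {j : ℕ} (hj : j ≤ k) (ω : MultiCfg (F.P p.K) (SU N) (FluctV N)) : (WtOfRecord₁₃H F N θg p s').ζ j ∅ ω = 1 := by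
  rw [WtOfRecord₁₃H_ζ_eq_ζ0, hζ, Omega_eq_univ_of_Omega_succ_univ s' hΩ (Nat.succ_pos j) (Nat.succ_le_succ hj), Set.compl_univ]
  exact Set.indicator_of_mem (Set.mem_singleton _) _

end Dial

/-! ## §2. ★★★ At the Gaussian dial the reference new side of EVERY Ω-top child is STRICTLY POSITIVE at EVERY new field (zero terms) -/

section Positivity

variable {θg : Stage13HParams F N}
variable (hζ : ∀ p n Ω Λ j Y ω, (θg.Zh p n Ω Λ).ζ0 j Y ω = Set.indicator {(Ω (j + 1))ᶜ} (1 : Set (Site (F.P p.K) 0) → ℝ) Y)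
  (hq : ∀ p n Ω Λ j Λ' ω, (θg.Zh p n Ω Λ).quad j Λ' ω = ∑ b ∈ (Set.toFinite (bondsIn j (Λ'ᶜ ∩ Ω (j + 1)))).toFinset, ‖(ω j).2 b‖ ^ 2)

include hq in
/-- **THE A-FIBRE INTEGRAND OF THE EMPTY BRANCH IS STRICTLY POSITIVE ON A SET OF POSITIVE LEBESGUE MASS AND GAUSSIAN-INTEGRABLE**: for a region `Y`, the integral over the
fluctuation variables on `sA = B_k(Y)` of `χ_A(Y, ∅)·e^{−½ Σ_{b∈B_k(Y)} ‖A_k(b)‖²}` — inserted into a configuration whose scale-`k` fluctuation variables vanish — is `> 0`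
(`δ_k > 0`: the (3.16) box `{‖a b‖ < δ_k}` is an open neighbourhood of `0`, product Lebesgue is positive on open sets, the Gaussian majorant is integrable).
[cite: Balaban1988Convergent, (2.21) p.258, (3.16) p.268, (3.21) p.269; Balaban1987RG1, (2.11) p.267 (shape only)] -/
theorem integral_afibre_emptyBranch_pos (p : B12.RunParams) {n : ℕ} (s : SeqOfRecord F θg.ν θg.τ9.M (gOfRecord₁₃ F N θg.toStage13Params p) p.K n) (k : ℕ)
    (Λ' : Set (Site (F.P p.K) 0)) (hδ : 0 < deltaOfRecord θg.ν (gOfRecord₁₃ F N θg.toStage13Params p) k θg.A₁)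
    {hdec : DecidableEq (PBond (F.P p.K) k)} (ω : MultiCfg (F.P p.K) (SU N) (FluctV N)) (hω : (ω k).2 = 0) :
    0 < ∫ a : ↥(Set.toFinite (bondsIn k (Λ'ᶜ ∩ s.Ω (k + 1)))).toFinset → FluctV N,
        (WtOfRecord₁₃H F N θg p s).w k Λ' (Λ'ᶜ ∩ s.Ω (k + 1)) ∅ (Function.update ω k (insA (Set.toFinite (bondsIn k (Λ'ᶜ ∩ s.Ω (k + 1)))).toFinset a (ω k)))
      ∂(Measure.pi fun _ => (volume : Measure (FluctV N))) := by
  set sA : Finset (PBond (F.P p.K) k) := (Set.toFinite (bondsIn k (Λ'ᶜ ∩ s.Ω (k + 1)))).toFinset with hsA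
  set upd : (↥sA → FluctV N) → MultiCfg (F.P p.K) (SU N) (FluctV N) := fun a => Function.update ω k (insA sA a (ω k)) with hupd
  -- the scale-`k` fluctuation variables of the updated configuration
  have hupdk : ∀ a, (upd a k).2 = Function.updateFinset (ω k).2 sA a := fun a => by
    simp only [hupd, Function.update_self]; rfl
  have hval : ∀ a (b : PBond (F.P p.K) k), (upd a k).2 b = if hb : b ∈ sA then a ⟨b, hb⟩ else 0 := fun a b => by
    rw [hupdk]
    simp only [Function.updateFinset_def]
    split_ifs with hb
    · rfl
    · rw [hω]; rfl
  -- the quadratic form at the updated configuration is the sum of squares of the inserted variables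
  have hquad : ∀ a, (θg.zhAt p s).quad k Λ' (upd a) = ∑ b : ↥sA, ‖a b‖ ^ 2 := fun a => by
    rw [Stage13HParams.zhAt_quad, hq, ← hsA, ← Finset.sum_coe_sort sA]
    refine Finset.sum_congr rfl fun b _ => ?_
    rw [hval, dif_pos b.2]
  -- the integrand, unfolded
  have hw : ∀ a, (WtOfRecord₁₃H F N θg p s).w k Λ' (Λ'ᶜ ∩ s.Ω (k + 1)) ∅ (upd a) =
      chiAW F N (FluctV N) θg.ν θg.A₁ p (gOfRecord₁₃ F N θg.toStage13Params p) k (Λ'ᶜ ∩ s.Ω (k + 1)) ∅ (upd a) * Real.exp (-(1 / 2 : ℝ) * ∑ b : ↥sA, ‖a b‖ ^ 2) :=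
    fun a => by
    show chiAW F N (FluctV N) θg.ν θg.A₁ p (gOfRecord₁₃ F N θg.toStage13Params p) k (Λ'ᶜ ∩ s.Ω (k + 1)) ∅ (upd a) *
        Real.exp (-(1 / 2 : ℝ) * (θg.zhAt p s).quad k Λ' (upd a)) = _
    rw [hquad]
  -- measurability of the integrand
  have hmu : Measurable upd := (measurable_update ω).comp (measurable_const.prodMk measurable_updateFinset)
  have hmeas : Measurable fun a => (WtOfRecord₁₃H F N θg p s).w k Λ' (Λ'ᶜ ∩ s.Ω (k + 1)) ∅ (upd a) :=
    (measurable_tkWeightsOfRecordP_w F N (FluctV N) θg.ν θg.A₁ p (gOfRecord₁₃ F N θg.toStage13Params p) (θg.zhAt p s) k Λ' _ ∅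
      (measurable_quad_of_gaussCert θg p hq s k Λ')).comp hmu
  -- nonnegativity and the Gaussian majorant
  have hnn : ∀ a, 0 ≤ (WtOfRecord₁₃H F N θg p s).w k Λ' (Λ'ᶜ ∩ s.Ω (k + 1)) ∅ (upd a) := fun a => by
    rw [hw]; exact mul_nonneg (chiAW_nonneg _ _ _ _) (Real.exp_nonneg _)
  have hle : ∀ a, (WtOfRecord₁₃H F N θg p s).w k Λ' (Λ'ᶜ ∩ s.Ω (k + 1)) ∅ (upd a) ≤ ∏ b : ↥sA, Real.exp (-(1 * ‖a b‖ ^ 2) / 2) := fun a => by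
    rw [hw]
    calc chiAW F N (FluctV N) θg.ν θg.A₁ p (gOfRecord₁₃ F N θg.toStage13Params p) k (Λ'ᶜ ∩ s.Ω (k + 1)) ∅ (upd a) * Real.exp (-(1 / 2 : ℝ) * ∑ b : ↥sA, ‖a b‖ ^ 2)
        ≤ Real.exp (-(1 / 2 : ℝ) * ∑ b : ↥sA, ‖a b‖ ^ 2) := mul_le_of_le_one_left (Real.exp_nonneg _) (chiAW_le_one _ _ _ _)
      _ ≤ ∏ b : ↥sA, Real.exp (-(1 * ‖a b‖ ^ 2) / 2) := exp_neg_half_le_gaussMajorant Finset.univ a (by rw [one_mul])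
  have hint_gauss : Integrable (fun a : ↥sA → FluctV N => ∏ b : ↥sA, Real.exp (-(1 * ‖a b‖ ^ 2) / 2)) (Measure.pi fun _ => (volume : Measure (FluctV N))) := by
    have hm : Measurable fun a : ↥sA → FluctV N => ∏ b : ↥sA, Real.exp (-(1 * ‖a b‖ ^ 2) / 2) :=
      Finset.measurable_prod _ fun b _ => Real.measurable_exp.comp (((measurable_const.mul ((measurable_pi_apply b).norm.pow_const 2)).neg).div_const 2)
    refine ⟨hm.aestronglyMeasurable, (hasFiniteIntegral_iff_ofReal (Filter.Eventually.of_forall fun a => ?_)).2 ?_⟩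
    · exact Finset.prod_nonneg fun b _ => (Real.exp_pos _).le
    · have e : (fun a : ↥sA → FluctV N => ENNReal.ofReal (∏ b : ↥sA, Real.exp (-(1 * ‖a b‖ ^ 2) / 2))) =
          fun a => ∏ b : ↥sA, ENNReal.ofReal (Real.exp (-(1 * ‖a b‖ ^ 2) / 2)) :=
        funext fun a => ENNReal.ofReal_prod_of_nonneg fun b _ => (Real.exp_pos _).le
      rw [e]
      exact (lintegral_gaussMajorant_ne_top (ι := ↥sA) (κ := Fin (N ^ 2 - 1)) one_pos).lt_top
  have hint : Integrable (fun a => (WtOfRecord₁₃H F N θg p s).w k Λ' (Λ'ᶜ ∩ s.Ω (k + 1)) ∅ (upd a)) (Measure.pi fun _ => (volume : Measure (FluctV N))) :=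
    hint_gauss.mono' hmeas.aestronglyMeasurable (Filter.Eventually.of_forall fun a => by
      rw [Real.norm_eq_abs, abs_of_nonneg (hnn a)]; exact hle a)
  -- the box `{‖a b‖ < δ_k}` lies in the support
  have hbox : Metric.ball (0 : ↥sA → FluctV N) (deltaOfRecord θg.ν (gOfRecord₁₃ F N θg.toStage13Params p) k θg.A₁) ⊆
      Function.support fun a => (WtOfRecord₁₃H F N θg p s).w k Λ' (Λ'ᶜ ∩ s.Ω (k + 1)) ∅ (upd a) := by
    intro a ha
    rw [mem_ball_zero_iff, pi_norm_lt_iff hδ] at ha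
    have hsmall : ∀ b : PBond (F.P p.K) k, ‖(upd a k).2 b‖ < deltaOfRecord θg.ν (gOfRecord₁₃ F N θg.toStage13Params p) k θg.A₁ := fun b => by
      rw [hval]
      split_ifs with hb
      · exact ha ⟨b, hb⟩
      · rwa [norm_zero]
    have hχ : chiAW F N (FluctV N) θg.ν θg.A₁ p (gOfRecord₁₃ F N θg.toStage13Params p) k (Λ'ᶜ ∩ s.Ω (k + 1)) ∅ (upd a) = 1 := by
      classical
      rw [chiAW_empty_eq_chiSmallAW', chiSmallAW_eq_ite]
      exact if_pos fun c _ b _ => hsmall b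
    rw [Function.mem_support, hw, hχ, one_mul]
    exact (Real.exp_pos _).ne'
  have hvol : 0 < (Measure.pi fun _ : ↥sA => (volume : Measure (FluctV N))) (Function.support fun a => (WtOfRecord₁₃H F N θg p s).w k Λ' (Λ'ᶜ ∩ s.Ω (k + 1)) ∅ (upd a)) :=
    lt_of_lt_of_le (Metric.isOpen_ball.measure_pos _ ⟨0, Metric.mem_ball_self hδ⟩) (measure_mono hbox)
  exact (integral_pos_iff_support_of_nonneg hnn hint).2 hvol

include hq in
/-- **… TIMES ANY FACTOR CONSTANT ALONG THE FIBRE** (the old generations' scalars and the fluctuation-blind operand): for weights `W` whose A-side is the Gaussian dial's,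
`∫ w_k(Λ′, Λ′ᶜ ∩ Ω_{k+1}, ∅)(ω_a) · G(ω_a) da > 0` as soon as `G(ω_a) = c > 0` for every inserted `a`. [cite: Balaban1988Convergent, (2.21) p.258, (3.23) p.270 (bookkeeping)] -/
theorem integral_afibre_emptyBranch_mul_pos (p : B12.RunParams) {n : ℕ} (s : SeqOfRecord F θg.ν θg.τ9.M (gOfRecord₁₃ F N θg.toStage13Params p) p.K n) (k : ℕ)
    (Λ' : Set (Site (F.P p.K) 0)) (hδ : 0 < deltaOfRecord θg.ν (gOfRecord₁₃ F N θg.toStage13Params p) k θg.A₁) {hdec : DecidableEq (PBond (F.P p.K) k)}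
    (W : TkWeights F N (FluctV N) p.K) (hw : ∀ j Λ₁ Y S₁, W.w j Λ₁ Y S₁ = (WtOfRecord₁₃H F N θg p s).w j Λ₁ Y S₁) (S₁ : Set (Site (F.P p.K) 0)) (hS₁ : S₁ = ∅)
    (ω : MultiCfg (F.P p.K) (SU N) (FluctV N)) (hω : (ω k).2 = 0) (G : MultiCfg (F.P p.K) (SU N) (FluctV N) → ℝ) (c : ℝ) (hc : 0 < c)
    (hG : ∀ a : ↥(Set.toFinite (bondsIn k (Λ'ᶜ ∩ s.Ω (k + 1)))).toFinset → FluctV N,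
      G (Function.update ω k (insA (Set.toFinite (bondsIn k (Λ'ᶜ ∩ s.Ω (k + 1)))).toFinset a (ω k))) = c) :
    0 < ∫ a : ↥(Set.toFinite (bondsIn k (Λ'ᶜ ∩ s.Ω (k + 1)))).toFinset → FluctV N,
        W.w k Λ' (Λ'ᶜ ∩ s.Ω (k + 1)) S₁ (Function.update ω k (insA (Set.toFinite (bondsIn k (Λ'ᶜ ∩ s.Ω (k + 1)))).toFinset a (ω k))) *
          G (Function.update ω k (insA (Set.toFinite (bondsIn k (Λ'ᶜ ∩ s.Ω (k + 1)))).toFinset a (ω k)))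
      ∂(Measure.pi fun _ => (volume : Measure (FluctV N))) := by
  subst hS₁
  simp_rw [hG, hw]
  rw [integral_mul_const]
  exact mul_pos (integral_afibre_emptyBranch_pos hq p s k Λ' hδ (hdec := hdec) ω hω) hc

include hq in
/-- ★★★ **AT THE GAUSSIAN DIAL THE NEW SIDE OF EVERY Ω-TOP CHILD IS STRICTLY POSITIVE AT EVERY NEW FIELD** — for ANY weight datum `W` with the dial's A-side, unit `ζ`-factors at the
empty region below the top and a positive top factor; any setting, residual, constant, background map; ZERO terms.  g18's closed form `…N11OmegaTopTStep.sect2Slot_eq_of_Omega_univ`: every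
`S_{k+1} = Y`-summand is `≥ 0`, the `Y = ∅` summand is `ζ_k · ∫ χ_A(Λᶜ, ∅)(a)e^{−½‖a‖²} · (Π_{j<k} 1·1) · e^{A_{k+1}(s′)(U(base V′))} da > 0` (the lower scalars are `1`: `ζ_j(∅) = 𝟙{Ω_{j+1} = 𝕋}`,
`w_j(𝕋,∅,∅) = e^0`; the operand does not read the inserted variables).  Needs `δ_k > 0` (print's (3.4): `deltaOfRecord_pos`).  NOT a claim about print's 𝐓-operation.
[cite: Balaban1988Convergent, (2.18) p.257, (2.21)–(2.23) p.258, (3.16) p.268, (3.21) p.269, (3.23)–(3.25) p.270, (3.4) p.265] -/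
theorem sect2Slot_pos_of_Omega_univ (p : B12.RunParams) {k : ℕ} (s' : SeqOfRecord F θg.ν θg.τ9.M (gOfRecord₁₃ F N θg.toStage13Params p) p.K (k + 1))
    (hΩ : s'.Ω (k + 1) = Set.univ) (hδ : 0 < deltaOfRecord θg.ν (gOfRecord₁₃ F N θg.toStage13Params p) k θg.A₁)
    (W : TkWeights F N (FluctV N) p.K) (hζk : ∀ ω, 0 < W.ζ k (s'.Ω (k + 1))ᶜ ω) (hζlt : ∀ j, j < k → ∀ ω, W.ζ j ∅ ω = 1)
    (hw : ∀ j Λ₁ Y S₁, W.w j Λ₁ Y S₁ = (WtOfRecord₁₃H F N θg p s').w j Λ₁ Y S₁)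
    {𝔸 : Type*} [NormedRing 𝔸] [NormedAlgebra ℂ 𝔸] [CompleteSpace 𝔸] (Sg : Sect2.Setting 𝔸 (SU N)) (Rz : Sect2.Residual (F.P p.K) 𝔸) (E' : ℝ) (U : BgMap F N p.K)
    (V' : GaugeField (F.P p.K) (k + 1) (SU N)) :
    0 < sect2Slot F N (FluctV N) p.K Sg Rz W s' (Sect2.TermValues.zero : Sect2.TermValues (F.P p.K) 𝔸 (FluctV N) θg.τ9.M) E' U V' := by
  have hdec : DecidableEq (PBond (F.P p.K) k) := fun a b => Classical.propDecidable (a = b)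
  rw [sect2Slot_eq_of_Omega_univ F N θg.ν θg.τ9 p (gOfRecord₁₃ F N θg.toStage13Params p) k Sg Rz W s' hΩ _ E' U V' (hdec := hdec)]
  have hw0 : ∀ j Λ₁ Y S₁ ω, 0 ≤ W.w j Λ₁ Y S₁ ω := fun j Λ₁ Y S₁ ω => by
    rw [hw]; exact mul_nonneg (chiAW_nonneg _ _ _ _) (Real.exp_nonneg _)
  have hG0 : ∀ (Y : Set (Site (F.P p.K) 0)) (ω : MultiCfg (F.P p.K) (SU N) (FluctV N)),
      0 ≤ (∏ j ∈ Finset.range k, W.ζ j ∅ ω * W.w j Set.univ ∅ ∅ ω) *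
        sect2Operand F N (FluctV N) p.K Sg Rz s' (Sect2.TermValues.zero : Sect2.TermValues (F.P p.K) 𝔸 (FluctV N) θg.τ9.M) E' U
          (Function.update (fun _ => ∅) (k + 1) Y, fun j => (ω j).2) (fun j => (ω j).1) := fun Y ω =>
    mul_nonneg (Finset.prod_nonneg fun j hj => by rw [hζlt j (Finset.mem_range.1 hj)]; exact mul_nonneg zero_le_one (hw0 _ _ _ _ _))
      (sect2Operand_pos _ _ _ _ _ _ _ _ _).le
  have hterm : ∀ Y : Set (Site (F.P p.K) 0), 0 ≤ W.ζ k (s'.Ω (k + 1))ᶜ (baseCfg (k + 1) V') *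
      aOp k (genDataOfRecord F N (FluctV N) θg.ν θg.τ9.M (gOfRecord₁₃ F N θg.toStage13Params p) p.K W s' (Function.update (fun _ => ∅) (k + 1) Y) k).sA
        (genDataOfRecord F N (FluctV N) θg.ν θg.τ9.M (gOfRecord₁₃ F N θg.toStage13Params p) p.K W s' (Function.update (fun _ => ∅) (k + 1) Y) k).w
        (fun ω => (∏ j ∈ Finset.range k, W.ζ j ∅ ω * W.w j Set.univ ∅ ∅ ω) *
          sect2Operand F N (FluctV N) p.K Sg Rz s' (Sect2.TermValues.zero : Sect2.TermValues (F.P p.K) 𝔸 (FluctV N) θg.τ9.M) E' U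
            (Function.update (fun _ => ∅) (k + 1) Y, fun j => (ω j).2) (fun j => (ω j).1)) (baseCfg (k + 1) V') := fun Y =>
    mul_nonneg (hζk _).le (aOp_nonneg k _
      (w := W.w k (s'.Λ (k + 1)) ((s'.Λ (k + 1))ᶜ ∩ s'.Ω (k + 1)) (Function.update (fun _ => (∅ : Set (Site (F.P p.K) 0))) (k + 1) Y (k + 1)))
      (hw0 _ _ _ _) (hG0 Y) _)
  have hmem : (∅ : Set (Site (F.P p.K) 0)) ∈ (Set.toFinite {Y : Set (Site (F.P p.K) 0) |
      Y ∈ SClassOfRecord F θg.ν (gOfRecord₁₃ F N θg.toStage13Params p) p.K (k + 1) ∧ Y ⊆ s'.Ω (k + 1) ∩ (s'.Λ (k + 1))ᶜ}).toFinset :=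
    (Set.Finite.mem_toFinset _).2 ⟨empty_mem_SClassOfRecord F θg.ν _ p.K (k + 1), Set.empty_subset _⟩
  refine lt_of_lt_of_le ?_ (Finset.single_le_sum
    (s := (Set.toFinite {Y : Set (Site (F.P p.K) 0) |
      Y ∈ SClassOfRecord F θg.ν (gOfRecord₁₃ F N θg.toStage13Params p) p.K (k + 1) ∧ Y ⊆ s'.Ω (k + 1) ∩ (s'.Λ (k + 1))ᶜ}).toFinset)
    (f := fun Y : Set (Site (F.P p.K) 0) => W.ζ k (s'.Ω (k + 1))ᶜ (baseCfg (k + 1) V') *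
      aOp k (genDataOfRecord F N (FluctV N) θg.ν θg.τ9.M (gOfRecord₁₃ F N θg.toStage13Params p) p.K W s' (Function.update (fun _ => ∅) (k + 1) Y) k).sA
        (genDataOfRecord F N (FluctV N) θg.ν θg.τ9.M (gOfRecord₁₃ F N θg.toStage13Params p) p.K W s' (Function.update (fun _ => ∅) (k + 1) Y) k).w
        (fun ω => (∏ j ∈ Finset.range k, W.ζ j ∅ ω * W.w j Set.univ ∅ ∅ ω) *
          sect2Operand F N (FluctV N) p.K Sg Rz s' (Sect2.TermValues.zero : Sect2.TermValues (F.P p.K) 𝔸 (FluctV N) θg.τ9.M) E' U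
            (Function.update (fun _ => ∅) (k + 1) Y, fun j => (ω j).2) (fun j => (ω j).1)) (baseCfg (k + 1) V'))
    (fun Y _ => hterm Y) hmem)
  refine mul_pos (hζk _) ?_
  rw [aOp_apply]
  -- the fibre-constant factor: lower scalars `= 1`, operand fluctuation-blind
  have hc₀ := sect2Operand_pos p.K Sg Rz s' (Sect2.TermValues.zero : Sect2.TermValues (F.P p.K) 𝔸 (FluctV N) θg.τ9.M) E' U
    (Function.update (fun _ => ∅) (k + 1) ∅, fun j => ((baseCfg (V := FluctV N) (k + 1) V') j).2) (fun j => ((baseCfg (V := FluctV N) (k + 1) V') j).1)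
  refine integral_afibre_emptyBranch_mul_pos hq p s' k (s'.Λ (k + 1)) hδ (hdec := hdec) W hw _
    (Function.update_self (k + 1) (∅ : Set (Site (F.P p.K) 0)) (fun _ => (∅ : Set (Site (F.P p.K) 0)))) (baseCfg (k + 1) V') (baseCfg_snd _ _ _)
    (fun ω => (∏ j ∈ Finset.range k, W.ζ j ∅ ω * W.w j Set.univ ∅ ∅ ω) *
      sect2Operand F N (FluctV N) p.K Sg Rz s' (Sect2.TermValues.zero : Sect2.TermValues (F.P p.K) 𝔸 (FluctV N) θg.τ9.M) E' U
        (Function.update (fun _ => ∅) (k + 1) ∅, fun j => (ω j).2) (fun j => (ω j).1)) _ hc₀ fun a => ?_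
  beta_reduce
  rw [Finset.prod_eq_one fun j hj => ?_, one_mul]
  · exact sect2Operand_zero_update_eq p.K Sg Rz s' E' U _ _ k _ rfl
  · rw [hζlt j (Finset.mem_range.1 hj), one_mul, hw, w_univ_empty_empty_eq_one hq]

include hζ hq in
/-- ★★★ **… IN PARTICULAR FOR THE REFERENCE NEW SIDE `J⁰_P(s′)` OF H's SWITCH–DIAL IDENTITY** (the dial's own weights with the top `ζ`-factor set to `1`) — the support hypothesis
`0 < ρ_{k+1}(s′)(V′) → 0 < J⁰_P(s′)(V′)` of `…N11K1BFaceSect2FormBySupports` HOLDS OUTRIGHT at every Ω-top child, every `V′`. [cite: Balaban1988Convergent, (2.18) p.257, (2.21)–(2.23) p.258, (3.23)–(3.25) p.270] -/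
theorem refNewSide_pos_of_Omega_univ (p : B12.RunParams) {k : ℕ} (s' : SeqOfRecord F θg.ν θg.τ9.M (gOfRecord₁₃ F N θg.toStage13Params p) p.K (k + 1))
    (hΩ : s'.Ω (k + 1) = Set.univ) (hδ : 0 < deltaOfRecord θg.ν (gOfRecord₁₃ F N θg.toStage13Params p) k θg.A₁)
    {𝔸 : Type*} [NormedRing 𝔸] [NormedAlgebra ℂ 𝔸] [CompleteSpace 𝔸] (Sg : Sect2.Setting 𝔸 (SU N)) (Rz : Sect2.Residual (F.P p.K) 𝔸) (E' : ℝ) (U : BgMap F N p.K)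
    (V' : GaugeField (F.P p.K) (k + 1) (SU N)) :
    0 < sect2Slot F N (FluctV N) p.K Sg Rz { WtOfRecord₁₃H F N θg p s' with ζ := fun j Y ω => if j = k then 1 else (WtOfRecord₁₃H F N θg p s').ζ j Y ω } s'
      (Sect2.TermValues.zero : Sect2.TermValues (F.P p.K) 𝔸 (FluctV N) θg.τ9.M) E' U V' :=
  sect2Slot_pos_of_Omega_univ hq p s' hΩ hδ
    (W := { WtOfRecord₁₃H F N θg p s' with ζ := fun j Y ω => if j = k then 1 else (WtOfRecord₁₃H F N θg p s').ζ j Y ω })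
    (fun ω => by show 0 < (if k = k then (1 : ℝ) else _); rw [if_pos rfl]; exact one_pos)
    (fun j hj ω => by
      show (if j = k then (1 : ℝ) else (WtOfRecord₁₃H F N θg p s').ζ j ∅ ω) = 1
      rw [if_neg (Nat.ne_of_lt hj)]
      exact ζ_empty_eq_one_of_Omega_univ hζ p s' hΩ hj.le ω)
    (fun _ _ _ _ => rfl) Sg Rz E' U V'

include hζ hq in
/-- ★★ **… AND FOR THE DIAL's OWN §2-FORM SLOT** (no top factor replaced: at an Ω-top child the top `ζ`-factor reads `ζ_k(∅) = 𝟙{Ω_{k+1} = 𝕋} = 1` anyway).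
[cite: Balaban1988Convergent, (2.18) p.257, (2.21)–(2.23) p.258, (3.23)–(3.25) p.270] -/
theorem newSide_pos_of_Omega_univ (p : B12.RunParams) {k : ℕ} (s' : SeqOfRecord F θg.ν θg.τ9.M (gOfRecord₁₃ F N θg.toStage13Params p) p.K (k + 1))
    (hΩ : s'.Ω (k + 1) = Set.univ) (hδ : 0 < deltaOfRecord θg.ν (gOfRecord₁₃ F N θg.toStage13Params p) k θg.A₁)
    {𝔸 : Type*} [NormedRing 𝔸] [NormedAlgebra ℂ 𝔸] [CompleteSpace 𝔸] (Sg : Sect2.Setting 𝔸 (SU N)) (Rz : Sect2.Residual (F.P p.K) 𝔸) (E' : ℝ) (U : BgMap F N p.K)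
    (V' : GaugeField (F.P p.K) (k + 1) (SU N)) :
    0 < sect2Slot F N (FluctV N) p.K Sg Rz (WtOfRecord₁₃H F N θg p s') s' (Sect2.TermValues.zero : Sect2.TermValues (F.P p.K) 𝔸 (FluctV N) θg.τ9.M) E' U V' :=
  sect2Slot_pos_of_Omega_univ hq p s' hΩ hδ _ (fun ω => by rw [hΩ, Set.compl_univ, ζ_empty_eq_one_of_Omega_univ hζ p s' hΩ le_rfl ω]; exact one_pos)
    (fun j hj ω => ζ_empty_eq_one_of_Omega_univ hζ p s' hΩ hj.le ω) (fun _ _ _ _ => rfl) Sg Rz E' U V'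

end Positivity


end Summit.QuantumFields.YangMills.Theorems.BalabanUVNodesN11K1SupportsOmegaTopGaussianDial

end
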